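import Summits.Ventures.PercRepro.S2ThirteenSixSpreadNine
import Summits.Ventures.PercRepro.S2CoindepCount

/-!
# PercRepro — S2: THE CLUSTER LEVER, PART A — TWO DISJOINT TRIANGLE CLUSTERS OF NULLITY `≥ 3` WITHOUT THREE PAIRWISE DISJOINT TRIANGLES
(p7, gen 15; sub-claim S2; the remaining spread rows of the cell `(13, 6)` and of its scaled `(12, 6)`)

THE NULLITY LEVER at corank `6` (**`nullity_le_ncard_inter_add`**: `ν(P) ≤ |B ∩ P| + ν(E ∖ B)`): a top `6`-set is a cobasis and meets
every set `P` in `≥ ν(P)` points (**`cobasis_inter_ge_of_nullity`**); a top `5`-set meets it in `≥ ν(P) − 1` points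
(**`top_five_inter_ge_of_nullity`**). THE CLUSTERS: on a spread core, a set `W` of `≤ 7` points and nullity `≥ 3` is met by no
triangle that is not inside it (**`triangle_subset_or_disjoint_of_cluster`**, Lemma U); with `t ≥ 6` triangles and no three pairwise
disjoint ones, a disjoint pair `E₁, E₂` carries every other triangle, and `E_i` with two (one) of the triangles meeting it is a
cluster `W_i` of `≤ 7` points and nullity `≥ 3` (`≥ 2`); the two clusters are disjoint (**`exists_clusters_of_no_three_disjoint`**:
`ν(W₁) + ν(W₂) ≥ 5`, both `≥ 3` once `t ≥ 7`). Hence every cobasis has `≥ ν₁ + ν₂` points and every top `5`-set `≥ ν₁ + ν₂ − 2`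
points in `W₁ ∪ W₂` (`≤ 14` points) — the counts of the rows `t = 7, 8` of `(13, 6)` (`U ≤ 7007 + 3003` against `16423`) and
`t = 6, 7, 8` of `(12, 6)`. Nothing about any cell or the window is claimed in this module. Axioms: standard.
-/

open scoped Matroid

namespace PercRepro

namespace S2

open Set

variable {α : Type}

/-- **The nullity lever, general form**: for `B, P ⊆ E`, `ν(P) ≤ |B ∩ P| + ν(E ∖ B)` — written with the slacks
`ρ P + k ≤ |P|` and `|E ∖ B| ≤ ρ(E ∖ B) + c`: `k ≤ |B ∩ P| + c`. -/
theorem nullity_le_ncard_inter_add (M : Matroid α) [M.Finite] {B P : Set α} (hP : P ⊆ M.E)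
    {c k : ℕ} (hc : (M.E \ B).encard ≤ M.eRk (M.E \ B) + c) (hPk : M.eRk P + k ≤ P.encard) :
    k ≤ (B ∩ P).ncard + c := by
  have hEfin := M.ground_finite
  have hPfin : P.Finite := hEfin.subset hP
  have hPB : P \ B ⊆ M.E \ B := Set.sdiff_subset_sdiff_left hP
  obtain ⟨r, hr⟩ := ENat.ne_top_iff_exists.1 (eRk_ne_top_of_finite (M := M) hP)
  obtain ⟨r', hr'⟩ := ENat.ne_top_iff_exists.1 (eRk_ne_top_of_finite (M := M) (hPB.trans Set.sdiff_subset))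
  obtain ⟨r'', hr''⟩ := ENat.ne_top_iff_exists.1 (eRk_ne_top_of_finite (M := M) (Set.sdiff_subset (s := M.E) (t := B)))
  -- `|E ∖ B| = |(E ∖ B) ∖ (P ∖ B)| + |P ∖ B|`
  have hc1 := Set.ncard_sdiff_add_ncard_of_subset hPB hEfin.sdiff
  -- `ρ(E ∖ B) ≤ ρ(P ∖ B) + |(E ∖ B) ∖ (P ∖ B)|`
  have h1 := M.eRk_union_le_eRk_add_encard (P \ B) ((M.E \ B) \ (P \ B))
  rw [Set.union_sdiff_cancel hPB, ← hr', ← hr'', ← ((hEfin.sdiff).sdiff).cast_ncard_eq] at h1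
  -- `ρ(P ∖ B) ≤ ρ P`
  have h3 : r' ≤ r := by
    have : (r' : ℕ∞) ≤ r := by rw [hr, hr']; exact M.eRk_mono Set.sdiff_subset
    exact_mod_cast this
  rw [← hr, ← hPfin.cast_ncard_eq] at hPk
  rw [← hr'', ← hEfin.sdiff.cast_ncard_eq] at hc
  have hsplit : P.ncard = (P \ B).ncard + (P ∩ B).ncard := by
    rw [← Set.ncard_union_eq Set.disjoint_sdiff_inter (hPfin.subset Set.sdiff_subset)
      (hPfin.subset Set.inter_subset_left), Set.sdiff_union_inter]
  rw [Set.inter_comm]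
  have h1' : r'' ≤ r' + ((M.E \ B) \ (P \ B)).ncard := by exact_mod_cast h1
  have hc' : (M.E \ B).ncard ≤ r'' + c := by exact_mod_cast hc
  have hPk' : r + k ≤ P.ncard := by exact_mod_cast hPk
  omega

/-- **A cobasis meets every set in at least its nullity**: at corank `6`, a top `6`-set `B` (`|B| = 6`, `E ∖ B` spanning) has
`|B ∩ P| ≥ k` whenever `ρ P + k ≤ |P|`. -/
theorem cobasis_inter_ge_of_nullity (M : Matroid α) [M.Finite] {p : ℕ} (hR : M.eRank = (p : ℕ∞))
    (hn : M.E.ncard = p + 6) {B : Set α} (hBE : B ⊆ M.E) (hB6 : B.ncard = 6) (hBs : M.eRk (M.E \ B) = M.eRank)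
    {P : Set α} (hP : P ⊆ M.E) {k : ℕ} (hPk : M.eRk P + k ≤ P.encard) : k ≤ (B ∩ P).ncard := by
  have hEfin := M.ground_finite
  have hc : (M.E \ B).encard ≤ M.eRk (M.E \ B) + 0 := by
    rw [add_zero, hBs, hR, ← hEfin.sdiff.cast_ncard_eq, Set.ncard_sdiff hBE (hEfin.subset hBE), hn, hB6]
    norm_cast
  simpa using nullity_le_ncard_inter_add M hP hc hPk

/-- **A top `5`-set meets every set in at least its nullity minus one**: at corank `6`, a top `5`-set `B` (`|B| = 5`, `E ∖ B`
spanning) has `|B ∩ P| + 1 ≥ k` whenever `ρ P + k ≤ |P|`. -/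
theorem top_five_inter_ge_of_nullity (M : Matroid α) [M.Finite] {p : ℕ} (hR : M.eRank = (p : ℕ∞))
    (hn : M.E.ncard = p + 6) {B : Set α} (hBE : B ⊆ M.E) (hB5 : B.ncard = 5) (hBs : M.eRk (M.E \ B) = M.eRank)
    {P : Set α} (hP : P ⊆ M.E) {k : ℕ} (hPk : M.eRk P + k ≤ P.encard) : k ≤ (B ∩ P).ncard + 1 := by
  have hEfin := M.ground_finite
  have hc : (M.E \ B).encard ≤ M.eRk (M.E \ B) + 1 := by
    rw [hBs, hR, ← hEfin.sdiff.cast_ncard_eq, Set.ncard_sdiff hBE (hEfin.subset hBE), hn, hB5]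
    norm_cast
  exact nullity_le_ncard_inter_add M hP hc hPk

/-- **A cluster is met by no triangle that is not inside it**: on a spread core, `W ⊆ E` with `|W| ≤ 7` and nullity `≥ 3`; a
triangle `T ⊄ W` is disjoint from `W` (else `W ∪ T` has `≤ 9` points and nullity `≥ 4`, Lemma U). -/
theorem triangle_subset_or_disjoint_of_cluster (M : Matroid α) [M.Finite]
    (h9 : ∀ X ⊆ M.E, X.ncard ≤ 9 → X.encard ≤ M.eRk X + 3)
    {W : Set α} (hW : W ⊆ M.E) (hW7 : W.ncard ≤ 7) (hW3 : M.eRk W + 3 ≤ W.encard)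
    {T : Set α} (hT : M.IsCircuit T) (hT3 : T.ncard = 3) : T ⊆ W ∨ Disjoint T W := by
  by_cases hsub : T ⊆ W
  · exact Or.inl hsub
  right
  by_contra hdis
  obtain ⟨x, hxT, hxW⟩ := Set.not_disjoint_iff.1 hdis
  have hEfin := M.ground_finite
  have hWfin : W.Finite := hEfin.subset hW
  have hTfin : T.Finite := hEfin.subset hT.subset_ground
  -- Lemma U: `ρ(W ∪ T) + |W| + 1 ≤ ρ W + |W ∪ T|`
  have hU := eRk_union_add_ncard_add_one_le M hW hT hsub
  -- `|W ∪ T| ≤ |W| + 2`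
  have hsize : (W ∪ T).ncard ≤ W.ncard + 2 := by
    have h1 := Set.ncard_union_add_ncard_inter W T hWfin hTfin
    have h2 : 0 < (W ∩ T).ncard := (Set.ncard_pos (hWfin.subset Set.inter_subset_left)).2 ⟨x, hxW, hxT⟩
    omega
  have hX9 : (W ∪ T).ncard ≤ 9 := by omega
  have hXE : W ∪ T ⊆ M.E := Set.union_subset hW hT.subset_ground
  have h9X := h9 (W ∪ T) hXE hX9
  obtain ⟨r, hr⟩ := ENat.ne_top_iff_exists.1 (eRk_ne_top_of_finite (M := M) hW)
  obtain ⟨r', hr'⟩ := ENat.ne_top_iff_exists.1 (eRk_ne_top_of_finite (M := M) hXE)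
  rw [← hr, ← hWfin.cast_ncard_eq] at hW3
  rw [← hr, ← hr'] at hU
  rw [← hr', ← (hWfin.union hTfin).cast_ncard_eq] at h9X
  have e1 : r + 3 ≤ W.ncard := by exact_mod_cast hW3
  have e2 : r' + W.ncard + 1 ≤ r + (W ∪ T).ncard := by exact_mod_cast hU
  have e3 : (W ∪ T).ncard ≤ r' + 3 := by exact_mod_cast h9X
  omega

/-- **A triangle with two distinct triangles meeting it spans a cluster**: `E ∪ F₁ ∪ F₂` has `≤ 7` points and nullity `≥ 3`. -/
theorem cluster_of_two_meeting (M : Matroid α) [M.Finite]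
    (hC1 : ∀ L ⊆ M.E, M.eRk L = 2 → L.ncard ≤ 3)
    {E F₁ F₂ : Set α} (hE : M.IsCircuit E) (hE3 : E.ncard = 3)
    (hF₁ : M.IsCircuit F₁) (hF₁3 : F₁.ncard = 3) (hF₁E : F₁ ≠ E) (hF₁m : ¬ Disjoint F₁ E)
    (hF₂ : M.IsCircuit F₂) (hF₂3 : F₂.ncard = 3) (hF₂E : F₂ ≠ E) (hF₂m : ¬ Disjoint F₂ E) (h12 : F₁ ≠ F₂) :
    (E ∪ F₁ ∪ F₂).ncard ≤ 7 ∧ M.eRk (E ∪ F₁ ∪ F₂) + 3 ≤ (E ∪ F₁ ∪ F₂).encard := by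
  have hEfin := M.ground_finite
  have hEf : E.Finite := hEfin.subset hE.subset_ground
  have hF₁f : F₁.Finite := hEfin.subset hF₁.subset_ground
  have hF₂f : F₂.Finite := hEfin.subset hF₂.subset_ground
  refine ⟨?_, ?_⟩
  · have e1 := ncard_sdiff_eq_two_of_triangles_meeting M hC1 hE hE3 hF₁ hF₁3 hF₁E hF₁m
    have e2 := ncard_sdiff_eq_two_of_triangles_meeting M hC1 hE hE3 hF₂ hF₂3 hF₂E hF₂m
    have hsub : E ∪ F₁ ∪ F₂ ⊆ E ∪ (F₁ \ E) ∪ (F₂ \ E) := by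
      intro y hy
      simp only [Set.mem_union, Set.mem_sdiff] at hy ⊢
      tauto
    have hfin : (E ∪ (F₁ \ E) ∪ (F₂ \ E)).Finite :=
      (hEf.union (hF₁f.subset Set.sdiff_subset)).union (hF₂f.subset Set.sdiff_subset)
    have hle := Set.ncard_le_ncard hsub hfin
    have u1 := Set.ncard_union_le (E ∪ (F₁ \ E)) (F₂ \ E)
    have u2 := Set.ncard_union_le E (F₁ \ E)
    omega
  · exact eRk_union_three_add_three_le_encard M hE hF₁ hF₂ (Ne.symm hF₁E)
      (not_subset_union_of_triangles_meeting M hC1 hE hE3 hF₂ hF₂3 hF₂E hF₂m hF₁ hF₁3 (Ne.symm h12))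

/-- **A triangle with one triangle meeting it spans a small cluster**: `E ∪ F` has `≤ 5` points and nullity `≥ 2`. -/
theorem cluster_of_one_meeting (M : Matroid α) [M.Finite]
    (hC1 : ∀ L ⊆ M.E, M.eRk L = 2 → L.ncard ≤ 3)
    {E F : Set α} (hE : M.IsCircuit E) (hE3 : E.ncard = 3)
    (hF : M.IsCircuit F) (hF3 : F.ncard = 3) (hFE : F ≠ E) (hFm : ¬ Disjoint F E) :
    (E ∪ F).ncard ≤ 5 ∧ M.eRk (E ∪ F) + 2 ≤ (E ∪ F).encard := by
  have hEfin := M.ground_finite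
  have hEf : E.Finite := hEfin.subset hE.subset_ground
  have hFf : F.Finite := hEfin.subset hF.subset_ground
  refine ⟨?_, eRk_union_two_add_two_le_encard M hE hF (Ne.symm hFE)⟩
  have e1 := ncard_sdiff_eq_two_of_triangles_meeting M hC1 hE hE3 hF hF3 hFE hFm
  have hsub : E ∪ F ⊆ E ∪ (F \ E) := by
    intro y hy
    simp only [Set.mem_union, Set.mem_sdiff] at hy ⊢
    tauto
  have hle := Set.ncard_le_ncard hsub (hEf.union (hFf.subset Set.sdiff_subset))
  have u2 := Set.ncard_union_le E (F \ E)
  omega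

/-- A triangle `E'` disjoint from `E` is not inside the cluster `E ∪ F₁ ∪ F₂` of two triangles meeting `E`
(it would share two points with `F₁` or `F₂`). -/
theorem not_subset_cluster_of_disjoint (M : Matroid α) [M.Finite]
    (hC1 : ∀ L ⊆ M.E, M.eRk L = 2 → L.ncard ≤ 3)
    {E F₁ F₂ E' : Set α}
    (hF₁ : M.IsCircuit F₁) (hF₁3 : F₁.ncard = 3) (hF₁m : ¬ Disjoint F₁ E)
    (hF₂ : M.IsCircuit F₂) (hF₂3 : F₂.ncard = 3) (hF₂m : ¬ Disjoint F₂ E)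
    (hE' : M.IsCircuit E') (hE'3 : E'.ncard = 3) (hdis : Disjoint E' E) : ¬ E' ⊆ E ∪ F₁ ∪ F₂ := by
  intro hsub
  have hEfin := M.ground_finite
  have hE'f : E'.Finite := hEfin.subset hE'.subset_ground
  have hne₁ : E' ≠ F₁ := fun h => hF₁m (h ▸ hdis)
  have hne₂ : E' ≠ F₂ := fun h => hF₂m (h ▸ hdis)
  have h1 := ncard_inter_le_one_of_triangles M hC1 hE' hE'3 hF₁ hF₁3 hne₁
  have h2 := ncard_inter_le_one_of_triangles M hC1 hE' hE'3 hF₂ hF₂3 hne₂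
  -- `E' = (E' ∩ F₁) ∪ (E' ∩ F₂)` since `E' ∩ E = ∅`
  have hcover : E' ⊆ (E' ∩ F₁) ∪ (E' ∩ F₂) := by
    intro y hy
    rcases hsub hy with (h | h) | h
    · exact absurd (Set.mem_inter hy h) (Set.disjoint_iff_inter_eq_empty.1 hdis ▸ id)
    · exact Or.inl ⟨hy, h⟩
    · exact Or.inr ⟨hy, h⟩
  have hle := Set.ncard_le_ncard hcover ((hE'f.subset Set.inter_subset_left).union (hE'f.subset Set.inter_subset_left))
  have hu := Set.ncard_union_le (E' ∩ F₁) (E' ∩ F₂)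
  omega

end S2

end PercRepro
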